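import Mathlib.MeasureTheory.Integral.PeakFunction
import Mathlib.Analysis.SpecificLimits.Basic
import Literature.MathematicalPhysics.QuantumFieldTheory.VillainKernelAnalysis
import Literature.Probability.LatticeModels.VillainMonotonicityProofs
import HarnessLib

/-!
# Concentration of the Villain kernel at large stiffness: `v_K(φ) ≤ 5 e^{-Kδ²/2}` for
# `δ ≤ |φ| ≤ π`, and the pinning limit `K → ∞` of products `∏_u v_K(θ_u)^{k_u}` on an angle cube

Support file for the named fact
`Literature.Probability.LatticeModels.FrohlichSpencerVillainSpinWaveBound` (`VillainSpinWave.lean`: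
Fröhlich–Spencer 1982 as printed in Dario–Wu 2020, Prop. 1.1, first clause — the thermodynamic
limit of the zero-boundary-condition Villain two-point functions, "a consequence of correlation
inequalities"). The zero boundary condition of a smaller cube is imposed on a larger one by sending
to infinity the stiffness `K` of the edges to the grounded boundary (Ginibre monotonicity in `K` is
the tree's `pinnedVillainTwoPoint_mono`); this file supplies the analysis of that limit:

* `villainKernel_le_of_le_abs` — for `K ≥ 1` and `0 ≤ δ ≤ |φ| ≤ π`, `v_K(φ) ≤ 5 e^{-Kδ²/2}` (the
  term `n` of the theta series is `≤ e^{-Kδ²/2}` for `n = 0` and `≤ e^{-Kδ²/2} e^{-(3Kπ²/2)(|n|-1)}`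
  otherwise, `sq_add_two_pi_mul_intCast_ge_of_ne_zero`; two geometric series,
  `hasSum_villainKernel_majorant`); `villainKernel_le_five`;
* for a product weight `∏_u v_K(b_u)^{k_u}` on an angle cube `[-π,π)^S` (`k_u ≥ 1`): the upper bound
  `5^{∑k} e^{-Kδ²/2}` when some `|b_u| ≥ δ` (`prod_villainKernel_pow_le_of_le_abs`), the lower bound
  `(2η)^{|S|} e^{-Kη²∑k/2}` on its integral (`mul_exp_le_setIntegral_prod_villainKernel_pow`, from
  `e^{-Kφ²/2} ≤ v_K(φ)`), positivity and integrability;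
* `tendstoUniformlyOn_prod_villainKernel_pow_div` — the NORMALISED weights tend to `0` uniformly off
  every neighbourhood of `0`, whence, by Mathlib's peak-function lemma
  (`tendsto_setIntegral_peak_smul_of_integrableOn_of_tendsto`) and dominated convergence for the
  parametric integral over the free block,
  **`tendsto_setIntegral_mul_prod_villainKernel_pow_div`**: for bounded continuous `G(b, a)`,
  `(∫_{[-π,π)^S×[-π,π)^I} G ∏_u v_K(b_u)^{k_u}) / (∫_{[-π,π)^S} ∏_u v_K^{k_u}) → ∫_{[-π,π)^I} G(0,a) da`
  as `K → ∞`, and its ratio form `…_div_setIntegral` (two observables `G, G'`, `∫ G'(0,·) > 0`);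
* `setIntegral_angleCube_eq_setIntegral_prod` (splitting `[-π,π)^V` along a predicate `p` with the
  volume-preserving `MeasurableEquiv.piEquivPiSubtypeProd`) and the single-cube form
  **`tendsto_setIntegral_mul_prod_villainKernel_pow_div_of_pinned`**:
  `(∫_{[-π,π)^V} g ∏_{u ∈ p} v_K(θ_u)^{k_u}) / (∫ g' ∏ …) → (∫ g(ā) da)/(∫ g'(ā) da)`, `ā` the
  extension of `a ∈ [-π,π)^{¬p}` by `0` on the pinned coordinates — Gibbs expectations with a block
  of angles coupled to `0` at stiffness `K` converge to those with the block SET to `0`.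

Everything is PROVED; theorems only, no definition and no named fact is introduced.

## References

* [DarioWu2020] P. Dario, W. Wu, arXiv:2002.02946, Ch. 1 §1 (PDF p. 4).
* [FrohlichSpencerCMP1982] J. Fröhlich, T. Spencer, Comm. Math. Phys. 83 (1982) 411–454, (2.2)
  (the Villain kernel).
-/

noncomputable section

open MeasureTheory Filter Finset Set Real
open scoped Topology

namespace Literature.Probability.LatticeModels

open Literature.MathematicalPhysics.QuantumFieldTheory

/-! ### The Villain kernel is uniformly small away from `2πℤ` -/

/-- For `δ ≤ |φ| ≤ π` and an integer `n ≠ 0`: `δ² + 3π²(|n| − 1) ≤ (φ + 2πn)²`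
(`|φ + 2πn| ≥ π(2|n| − 1)` and `(2|n| − 1)² − 1 − 3(|n| − 1) = (4|n| − 3)(|n| − 1) ≥ 0`). [folklore] -/
theorem sq_add_two_pi_mul_intCast_ge_of_ne_zero {φ δ : ℝ} (hφ : |φ| ≤ π) (hδφ : δ ≤ |φ|) (hδ : 0 ≤ δ)
    {n : ℤ} (hn : n ≠ 0) :
    δ ^ 2 + 3 * π ^ 2 * (|(n : ℝ)| - 1) ≤ (φ + 2 * π * n) ^ 2 := by
  have hn1 : (1 : ℝ) ≤ |(n : ℝ)| := by exact_mod_cast Int.one_le_abs hn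
  have hπ : 0 < π := Real.pi_pos
  -- `π (2|n| - 1) ≤ |φ + 2πn|`
  have htri : 2 * π * |(n : ℝ)| - |φ| ≤ |φ + 2 * π * n| := by
    have h := abs_sub_abs_le_abs_sub (2 * π * n) (-φ)
    rw [abs_neg, sub_neg_eq_add, add_comm] at h
    rwa [abs_mul, abs_of_pos (by positivity : (0 : ℝ) < 2 * π)] at h
  have hlow : π * (2 * |(n : ℝ)| - 1) ≤ |φ + 2 * π * n| := by nlinarith
  have hlow0 : 0 ≤ π * (2 * |(n : ℝ)| - 1) := by nlinarith
  have hsq : (π * (2 * |(n : ℝ)| - 1)) ^ 2 ≤ (φ + 2 * π * n) ^ 2 := by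
    rw [← sq_abs (φ + 2 * π * n)]
    exact pow_le_pow_left₀ hlow0 hlow 2
  have hδπ : δ ^ 2 ≤ π ^ 2 := by
    have : δ ≤ π := hδφ.trans hφ
    exact pow_le_pow_left₀ hδ this 2
  nlinarith [mul_nonneg (mul_nonneg (sq_nonneg π) (by linarith : (0 : ℝ) ≤ 4 * |(n : ℝ)| - 3))
    (by linarith : (0 : ℝ) ≤ |(n : ℝ)| - 1)]

/-- The term-wise majorant: for `K ≥ 0` and `0 ≤ δ ≤ |φ| ≤ π`,
`exp(-(K/2)(φ + 2πn)²) ≤ e^{-Kδ²/2} · (1 if n = 0, e^{-(3Kπ²/2)(|n| − 1)} otherwise)`. [folklore] -/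
theorem villainKernel_term_le_of_le_abs {K φ δ : ℝ} (hK : 0 ≤ K) (hφ : |φ| ≤ π) (hδφ : δ ≤ |φ|)
    (hδ : 0 ≤ δ) (n : ℤ) :
    Real.exp (-(K / 2) * (φ + 2 * π * n) ^ 2) ≤
      Real.exp (-(K / 2) * δ ^ 2) *
        (if n = 0 then 1 else Real.exp (-(3 * K * π ^ 2 / 2) * (|(n : ℝ)| - 1))) := by
  split_ifs with hn
  · subst hn
    rw [mul_one, Int.cast_zero, mul_zero, add_zero]
    refine Real.exp_le_exp.2 ?_
    have : δ ^ 2 ≤ φ ^ 2 := by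
      rw [← sq_abs φ]; exact pow_le_pow_left₀ hδ hδφ 2
    nlinarith
  · rw [← Real.exp_add]
    refine Real.exp_le_exp.2 ?_
    have h := sq_add_two_pi_mul_intCast_ge_of_ne_zero hφ hδφ hδ hn
    nlinarith

/-- The majorant sums to `e^{-Kδ²/2} (1 + 2/(1 − e^{-3Kπ²/2}))` (`K > 0`; two geometric series).
[folklore] -/
theorem hasSum_villainKernel_majorant {K : ℝ} (hK : 0 < K) (c : ℝ) :
    HasSum (fun n : ℤ => c * (if n = 0 then 1 else Real.exp (-(3 * K * π ^ 2 / 2) * (|(n : ℝ)| - 1))))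
      (c * ((1 - Real.exp (-(3 * K * π ^ 2 / 2)))⁻¹ + 1 + (1 - Real.exp (-(3 * K * π ^ 2 / 2)))⁻¹)) := by
  refine HasSum.mul_left c ?_
  set a : ℝ := 3 * K * π ^ 2 / 2 with ha
  have ha0 : 0 < a := by positivity
  have hq0 : 0 ≤ Real.exp (-a) := (Real.exp_pos _).le
  have hq1 : Real.exp (-a) < 1 := Real.exp_lt_one_iff.2 (by linarith)
  have hgeo := hasSum_geometric_of_lt_one hq0 hq1
  have hpos : ∀ n : ℕ, (fun m : ℤ => if m = 0 then (1 : ℝ) else Real.exp (-a * (|(m : ℝ)| - 1)))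
      ((n : ℤ) + 1) = Real.exp (-a) ^ n := by
    intro n
    have h1 : ((n : ℤ) + 1) ≠ 0 := by omega
    simp only [h1, if_false]
    rw [← Real.exp_nat_mul]
    congr 1
    push_cast
    rw [abs_of_nonneg (by positivity)]
    ring
  have hneg : ∀ n : ℕ, (fun m : ℤ => if m = 0 then (1 : ℝ) else Real.exp (-a * (|(m : ℝ)| - 1)))
      (-((n : ℤ) + 1)) = Real.exp (-a) ^ n := by
    intro n
    have h1 : (-((n : ℤ) + 1)) ≠ 0 := by omega
    simp only [h1, if_false]
    rw [← Real.exp_nat_mul]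
    congr 1
    push_cast
    rw [abs_neg, abs_of_nonneg (by positivity)]
    ring
  have h := HasSum.of_add_one_of_neg_add_one
    (f := fun m : ℤ => if m = 0 then (1 : ℝ) else Real.exp (-a * (|(m : ℝ)| - 1)))
    (hgeo.congr_fun fun n => hpos n) (hgeo.congr_fun fun n => hneg n)
  simp only [if_true] at h
  exact h

/-- **The Villain kernel is uniformly small away from `2πℤ` at large stiffness**: for `K ≥ 1`
and `0 ≤ δ ≤ |φ| ≤ π`, `v_K(φ) ≤ 5 e^{-Kδ²/2}`. (In particular `v_K ≤ 5` on `[-π, π]`, `δ = 0`.)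
[folklore] -/
theorem villainKernel_le_of_le_abs {K φ δ : ℝ} (hK : 1 ≤ K) (hφ : |φ| ≤ π) (hδφ : δ ≤ |φ|) (hδ : 0 ≤ δ) :
    villainKernel K φ ≤ 5 * Real.exp (-(K / 2) * δ ^ 2) := by
  have hK0 : 0 < K := by linarith
  have hmaj := hasSum_villainKernel_majorant hK0 (Real.exp (-(K / 2) * δ ^ 2))
  have hle : villainKernel K φ ≤ Real.exp (-(K / 2) * δ ^ 2) *
      ((1 - Real.exp (-(3 * K * π ^ 2 / 2)))⁻¹ + 1 + (1 - Real.exp (-(3 * K * π ^ 2 / 2)))⁻¹) := by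
    rw [villainKernel, ← hmaj.tsum_eq]
    exact Summable.tsum_le_tsum (fun n => villainKernel_term_le_of_le_abs hK0.le hφ hδφ hδ n)
      (summable_villainKernel_term hK0 φ) hmaj.summable
  refine hle.trans ?_
  -- `e^{-3Kπ²/2} ≤ 1/2`, so the bracket is `≤ 2 + 1 + 2`
  have hx : (1 : ℝ) ≤ 3 * K * π ^ 2 / 2 := by nlinarith [Real.pi_gt_three]
  have hq : Real.exp (-(3 * K * π ^ 2 / 2)) ≤ 1 / 2 := by
    rw [Real.exp_neg]
    have h := Real.add_one_le_exp (3 * K * π ^ 2 / 2)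
    rw [inv_le_comm₀ (Real.exp_pos _) (by norm_num)]
    linarith
  have hinv : (1 - Real.exp (-(3 * K * π ^ 2 / 2)))⁻¹ ≤ 2 := by
    rw [inv_le_comm₀ (by linarith) (by norm_num)]
    linarith
  have hE : 0 ≤ Real.exp (-(K / 2) * δ ^ 2) := (Real.exp_pos _).le
  calc Real.exp (-(K / 2) * δ ^ 2) *
        ((1 - Real.exp (-(3 * K * π ^ 2 / 2)))⁻¹ + 1 + (1 - Real.exp (-(3 * K * π ^ 2 / 2)))⁻¹)
      ≤ Real.exp (-(K / 2) * δ ^ 2) * (2 + 1 + 2) := by gcongr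
    _ = 5 * Real.exp (-(K / 2) * δ ^ 2) := by ring

/-- `v_K ≤ 5` on `[-π, π]` for `K ≥ 1`. [folklore] -/
theorem villainKernel_le_five {K φ : ℝ} (hK : 1 ≤ K) (hφ : |φ| ≤ π) : villainKernel K φ ≤ 5 := by
  have h := villainKernel_le_of_le_abs hK hφ (abs_nonneg φ) le_rfl
  have h1 : Real.exp (-(K / 2) * 0 ^ 2) = 1 := by simp
  linarith [h1]

/-! ### Angle cubes: measurability, finite and positive volume, `|θ_u| ≤ π` -/

section Cube

variable {W : Type*} [Fintype W]

/-- The angle cube `[-π, π)^W` is measurable. [folklore] -/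
theorem measurableSet_angleCube' : MeasurableSet (angleCube W) :=
  MeasurableSet.univ_pi fun _ => measurableSet_Ico

/-- The angle cube has finite volume. [folklore] -/
theorem volume_angleCube_ne_top : volume (angleCube W) ≠ ⊤ := by
  rw [angleCube, volume_pi_pi]
  exact ENNReal.prod_ne_top fun _ _ => by rw [Real.volume_Ico]; exact ENNReal.ofReal_ne_top

omit [Fintype W] in
/-- On the angle cube every coordinate satisfies `|θ_u| ≤ π`. [folklore] -/
theorem abs_le_pi_of_mem_angleCube {θ : W → ℝ} (hθ : θ ∈ angleCube W) (u : W) : |θ u| ≤ π := by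
  have h := hθ u (Set.mem_univ u)
  rw [Set.mem_Ico] at h
  exact abs_le.2 ⟨h.1, h.2.le⟩

omit [Fintype W] in
/-- A small closed cube `[-η, η]^W`, `0 < η < π`, lies in the angle cube. [folklore] -/
theorem pi_Icc_subset_angleCube {η : ℝ} (hη : η < π) :
    (Set.pi univ fun _ : W => Icc (-η) η) ⊆ angleCube W := by
  intro θ hθ u _
  have h := hθ u (Set.mem_univ u)
  rw [Set.mem_Icc] at h
  rw [Set.mem_Ico]
  constructor <;> linarith [h.1, h.2]

end Cube

/-! ### The product weight `∏_u v_K(θ_u)^{k_u}`: bounds -/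

section Weight

variable {S : Type*} [Fintype S]

/-- The product weight is non-negative (`K > 0`). [folklore] -/
theorem prod_villainKernel_pow_nonneg {K : ℝ} (hK : 0 < K) (k : S → ℕ) (b : S → ℝ) :
    0 ≤ ∏ u, villainKernel K (b u) ^ k u :=
  Finset.prod_nonneg fun _ _ => pow_nonneg (villainKernel_pos hK _).le _

/-- The product weight is positive (`K > 0`). [folklore] -/
theorem prod_villainKernel_pow_pos {K : ℝ} (hK : 0 < K) (k : S → ℕ) (b : S → ℝ) :
    0 < ∏ u, villainKernel K (b u) ^ k u :=
  Finset.prod_pos fun _ _ => pow_pos (villainKernel_pos hK _) _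

/-- The product weight is continuous (`K > 0`). [folklore] -/
theorem continuous_prod_villainKernel_pow {K : ℝ} (hK : 0 < K) (k : S → ℕ) :
    Continuous fun b : S → ℝ => ∏ u, villainKernel K (b u) ^ k u :=
  continuous_finsetProd _ fun u _ => ((continuous_villainKernel hK).comp (continuous_apply u)).pow _

/-- **Upper bound away from `0`**: for `K ≥ 1`, `k_u ≥ 1`, on the angle cube, if `δ ≤ |b_{u₀}|` for
some coordinate then `∏_u v_K(b_u)^{k_u} ≤ 5^{∑ k} e^{-Kδ²/2}`. [folklore] -/
theorem prod_villainKernel_pow_le_of_le_abs {K δ : ℝ} (hK : 1 ≤ K) (hδ : 0 ≤ δ) {k : S → ℕ}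
    (hk : ∀ u, 1 ≤ k u) {b : S → ℝ} (hb : b ∈ angleCube S) {u₀ : S} (hu₀ : δ ≤ |b u₀|) :
    ∏ u, villainKernel K (b u) ^ k u ≤ 5 ^ (∑ u, k u) * Real.exp (-(K / 2) * δ ^ 2) := by
  classical
  have hK0 : 0 < K := by linarith
  have hE1 : Real.exp (-(K / 2) * δ ^ 2) ≤ 1 := Real.exp_le_one_iff.2 (by nlinarith [sq_nonneg δ])
  have hE0 : 0 ≤ Real.exp (-(K / 2) * δ ^ 2) := (Real.exp_pos _).le
  -- term-wise bounds
  have hterm : ∀ u, villainKernel K (b u) ^ k u ≤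
      5 ^ k u * (if u = u₀ then Real.exp (-(K / 2) * δ ^ 2) else 1) := by
    intro u
    have hv0 : 0 ≤ villainKernel K (b u) := (villainKernel_pos hK0 _).le
    by_cases hu : u = u₀
    · subst hu
      rw [if_pos rfl]
      have h1 : villainKernel K (b u) ≤ 5 * Real.exp (-(K / 2) * δ ^ 2) :=
        villainKernel_le_of_le_abs hK (abs_le_pi_of_mem_angleCube hb u) hu₀ hδ
      calc villainKernel K (b u) ^ k u ≤ (5 * Real.exp (-(K / 2) * δ ^ 2)) ^ k u :=
            pow_le_pow_left₀ hv0 h1 _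
        _ = 5 ^ k u * Real.exp (-(K / 2) * δ ^ 2) ^ k u := mul_pow _ _ _
        _ ≤ 5 ^ k u * Real.exp (-(K / 2) * δ ^ 2) := by
            refine mul_le_mul_of_nonneg_left ?_ (by positivity)
            exact pow_le_of_le_one hE0 hE1 (by have := hk u; omega)
    · rw [if_neg hu, mul_one]
      exact pow_le_pow_left₀ hv0 (villainKernel_le_five hK (abs_le_pi_of_mem_angleCube hb u)) _
  calc ∏ u, villainKernel K (b u) ^ k u
      ≤ ∏ u, (5 ^ k u * (if u = u₀ then Real.exp (-(K / 2) * δ ^ 2) else 1)) :=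
        Finset.prod_le_prod (fun u _ => pow_nonneg (villainKernel_pos hK0 _).le _) fun u _ => hterm u
    _ = 5 ^ (∑ u, k u) * Real.exp (-(K / 2) * δ ^ 2) := by
        rw [Finset.prod_mul_distrib, Finset.prod_pow_eq_pow_sum, Finset.prod_ite_eq' Finset.univ u₀,
          if_pos (Finset.mem_univ _)]

/-- **Lower bound near `0`**: for `K ≥ 0`, `|b_u| ≤ η` for all `u` implies
`e^{-K η² (∑ k)/2} ≤ ∏_u v_K(b_u)^{k_u}`. [folklore] -/
theorem exp_le_prod_villainKernel_pow {K η : ℝ} (hK : 0 < K) (k : S → ℕ) {b : S → ℝ}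
    (hb : ∀ u, |b u| ≤ η) :
    Real.exp (-(K / 2) * η ^ 2 * ∑ u, k u) ≤ ∏ u, villainKernel K (b u) ^ k u := by
  have hterm : ∀ u, Real.exp (-(K / 2) * η ^ 2) ^ k u ≤ villainKernel K (b u) ^ k u := by
    intro u
    refine pow_le_pow_left₀ (Real.exp_pos _).le ?_ _
    refine le_trans (Real.exp_le_exp.2 ?_) (exp_le_villainKernel hK (b u))
    have : (b u) ^ 2 ≤ η ^ 2 := by
      rw [← sq_abs (b u)]; exact pow_le_pow_left₀ (abs_nonneg _) (hb u) 2
    nlinarith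
  calc Real.exp (-(K / 2) * η ^ 2 * ∑ u, k u) = ∏ u, Real.exp (-(K / 2) * η ^ 2) ^ k u := by
        rw [Finset.prod_pow_eq_pow_sum, ← Real.exp_nat_mul]
        congr 1
        push_cast
        ring
    _ ≤ ∏ u, villainKernel K (b u) ^ k u :=
        Finset.prod_le_prod (fun u _ => pow_nonneg (Real.exp_pos _).le _) fun u _ => hterm u

/-- **Lower bound on the normalisation**: for `K > 0` and `0 < η < π`,
`(2η)^{|S|} e^{-Kη²(∑k)/2} ≤ ∫_{[-π,π)^S} ∏_u v_K(b_u)^{k_u} db`. [folklore] -/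
theorem mul_exp_le_setIntegral_prod_villainKernel_pow {K η : ℝ} (hK : 0 < K) (hη0 : 0 < η) (hη : η < π)
    (k : S → ℕ) :
    (2 * η) ^ Fintype.card S * Real.exp (-(K / 2) * η ^ 2 * ∑ u, k u) ≤
      ∫ b in angleCube S, ∏ u, villainKernel K (b u) ^ k u := by
  have hsub := pi_Icc_subset_angleCube (W := S) hη
  have hvolI : volume (Set.pi univ fun _ : S => Icc (-η) η) = ENNReal.ofReal (2 * η) ^ Fintype.card S := by
    rw [volume_pi_pi]
    simp only [Real.volume_Icc, show η - -η = 2 * η by ring, Finset.prod_const, Finset.card_univ]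
  have hint : IntegrableOn (fun b : S → ℝ => ∏ u, villainKernel K (b u) ^ k u) (angleCube S) := by
    obtain ⟨C, hC⟩ : ∃ C, ∀ b : S → ℝ, b ∈ angleCube S → ∏ u, villainKernel K (b u) ^ k u ≤ C := by
      obtain ⟨M, hM⟩ := exists_villainKernel_le hK
      refine ⟨∏ u : S, (max M 1) ^ k u, fun b _ => Finset.prod_le_prod
        (fun u _ => pow_nonneg (villainKernel_pos hK _).le _) fun u _ => ?_⟩
      exact pow_le_pow_left₀ (villainKernel_pos hK _).le ((hM _).trans (le_max_left _ _)) _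
    refine Measure.integrableOn_of_bounded (M := C) volume_angleCube_ne_top
      (continuous_prod_villainKernel_pow hK k).aestronglyMeasurable ?_
    rw [ae_restrict_iff' measurableSet_angleCube']
    refine Filter.Eventually.of_forall fun b hb => ?_
    rw [Real.norm_eq_abs, abs_of_nonneg (prod_villainKernel_pow_nonneg hK k b)]
    exact hC b hb
  calc (2 * η) ^ Fintype.card S * Real.exp (-(K / 2) * η ^ 2 * ∑ u, k u)
      = ∫ _ in Set.pi univ (fun _ : S => Icc (-η) η), Real.exp (-(K / 2) * η ^ 2 * ∑ u, k u) := by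
        rw [setIntegral_const, smul_eq_mul, measureReal_def, hvolI, ENNReal.toReal_pow,
          ENNReal.toReal_ofReal (by linarith)]
    _ ≤ ∫ b in Set.pi univ (fun _ : S => Icc (-η) η), ∏ u, villainKernel K (b u) ^ k u := by
        refine setIntegral_mono_on (integrableOn_const ?_) (hint.mono_set hsub)
          (MeasurableSet.univ_pi fun _ => measurableSet_Icc) fun b hb => ?_
        · rw [hvolI]; exact ENNReal.pow_ne_top ENNReal.ofReal_ne_top
        · exact exp_le_prod_villainKernel_pow hK k fun u => by
            have h := hb u (Set.mem_univ u)
            exact abs_le.2 ⟨h.1, h.2⟩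
    _ ≤ ∫ b in angleCube S, ∏ u, villainKernel K (b u) ^ k u :=
        setIntegral_mono_set hint (Filter.Eventually.of_forall fun b => prod_villainKernel_pow_nonneg hK k b)
          (Filter.Eventually.of_forall hsub)

/-- The product weight is integrable on the angle cube (`K > 0`). [folklore] -/
theorem integrableOn_prod_villainKernel_pow {K : ℝ} (hK : 0 < K) (k : S → ℕ) :
    IntegrableOn (fun b : S → ℝ => ∏ u, villainKernel K (b u) ^ k u) (angleCube S) := by
  obtain ⟨M, hM⟩ := exists_villainKernel_le hK
  refine Measure.integrableOn_of_bounded (M := ∏ u : S, (max M 1) ^ k u) volume_angleCube_ne_top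
    (continuous_prod_villainKernel_pow hK k).aestronglyMeasurable (Filter.Eventually.of_forall fun b => ?_)
  rw [Real.norm_eq_abs, abs_of_nonneg (prod_villainKernel_pow_nonneg hK k b)]
  exact Finset.prod_le_prod (fun u _ => pow_nonneg (villainKernel_pos hK _).le _) fun u _ =>
    pow_le_pow_left₀ (villainKernel_pos hK _).le ((hM _).trans (le_max_left _ _)) _

/-- The normalisation `∫_{[-π,π)^S} ∏_u v_K(b_u)^{k_u} db` is positive (`K > 0`). [folklore] -/
theorem setIntegral_prod_villainKernel_pow_pos {K : ℝ} (hK : 0 < K) (k : S → ℕ) :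
    0 < ∫ b in angleCube S, ∏ u, villainKernel K (b u) ^ k u := by
  have hη : (1 : ℝ) < π := by linarith [Real.pi_gt_three]
  refine lt_of_lt_of_le ?_ (mul_exp_le_setIntegral_prod_villainKernel_pow hK one_pos hη k)
  positivity

end Weight

/-! ### The pinning limit `K → ∞` (an approximate identity on the angle cube) -/

section Peak

variable {I S : Type*} [Fintype I] [Fintype S]

omit [Fintype S] in
/-- If `‖b‖ ≥ δ > 0` in the sup norm then some coordinate has `|b_u| ≥ δ`. [folklore] -/
theorem exists_le_abs_apply_of_le_norm [Fintype S] {δ : ℝ} (hδ : 0 < δ) {b : S → ℝ} (hb : δ ≤ ‖b‖) :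
    ∃ u, δ ≤ |b u| := by
  by_contra h
  push Not at h
  have : ‖b‖ < δ := (pi_norm_lt_iff hδ).2 fun u => by rw [Real.norm_eq_abs]; exact h u
  linarith

/-- **The normalised product weights concentrate at `0`**: for `k_u ≥ 1` and every open `U ∋ 0`,
`(∏_u v_K(b_u)^{k_u}) / ∫_{[-π,π)^S} ∏_u v_K^{k_u} → 0` uniformly on `[-π,π)^S ∖ U` as `K → ∞`
(numerator `≤ 5^{∑k} e^{-Kδ²/2}` off the ball `B(0,δ) ⊆ U`, denominator `≥ (2η)^{|S|} e^{-Kη²∑k/2}`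
with `η = δ/(2(∑k + 1))`). [folklore] -/
theorem tendstoUniformlyOn_prod_villainKernel_pow_div (k : S → ℕ) (hk : ∀ u, 1 ≤ k u)
    {U : Set (S → ℝ)} (hU : IsOpen U) (h0 : (0 : S → ℝ) ∈ U) :
    TendstoUniformlyOn (fun (K : ℝ) (b : S → ℝ) =>
        (∏ u, villainKernel K (b u) ^ k u) / ∫ b' in angleCube S, ∏ u, villainKernel K (b' u) ^ k u)
      0 atTop (angleCube S \ U) := by
  obtain ⟨δ₀, hδ₀, hball⟩ := Metric.isOpen_iff.1 hU 0 h0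
  set δ : ℝ := min δ₀ 1 with hδdef
  have hδ : 0 < δ := lt_min hδ₀ one_pos
  have hδ1 : δ ≤ 1 := min_le_right _ _
  set N : ℕ := ∑ u, k u with hN
  set η : ℝ := δ / (2 * (N + 1)) with hηdef
  have hN1 : (1 : ℝ) ≤ N + 1 := by linarith [(Nat.cast_nonneg N : (0 : ℝ) ≤ N)]
  have hη0 : 0 < η := by positivity
  have hηδ : η ≤ δ / 2 := by
    rw [hηdef, div_le_div_iff₀ (by positivity) (by norm_num)]
    nlinarith
  have hηπ : η < π := by linarith [Real.pi_gt_three]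
  have hηN : η ^ 2 * N ≤ δ ^ 2 / 4 := by
    have h1 : η * (N + 1) = δ / 2 := by rw [hηdef]; field_simp
    have h2 : η ^ 2 * N ≤ η ^ 2 * (N + 1) ^ 2 := by
      have : (N : ℝ) ≤ (N + 1) ^ 2 := by nlinarith [(Nat.cast_nonneg N : (0 : ℝ) ≤ N)]
      exact mul_le_mul_of_nonneg_left this (sq_nonneg η)
    calc η ^ 2 * N ≤ η ^ 2 * (N + 1) ^ 2 := h2
      _ = (η * (N + 1)) ^ 2 := by ring
      _ = δ ^ 2 / 4 := by rw [h1]; ring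
  -- the constant and the rate
  set C : ℝ := 5 ^ N / ((2 * η) ^ Fintype.card S) with hC
  have hC0 : 0 ≤ C := by positivity
  have hrate : Tendsto (fun K : ℝ => C * Real.exp (-(δ ^ 2 / 4) * K)) atTop (𝓝 0) := by
    have h := Real.tendsto_exp_atBot.comp (tendsto_id.const_mul_atTop_of_neg (by nlinarith : -(δ ^ 2 / 4) < 0))
    simpa using h.const_mul C
  rw [Metric.tendstoUniformlyOn_iff]
  intro ε hε
  filter_upwards [eventually_ge_atTop (1 : ℝ), (tendsto_order.1 hrate).2 ε hε] with K hK hKε b hb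
  have hK0 : 0 < K := by linarith
  obtain ⟨hbc, hbU⟩ := hb
  -- some coordinate is `≥ δ` in absolute value
  have hbδ : δ ≤ ‖b‖ := by
    by_contra h
    push Not at h
    exact hbU (hball (mem_ball_zero_iff.2 (h.trans_le (min_le_left _ _))))
  obtain ⟨u₀, hu₀⟩ := exists_le_abs_apply_of_le_norm hδ hbδ
  -- the bounds
  have hnum := prod_villainKernel_pow_le_of_le_abs hK hδ.le hk hbc hu₀
  have hden := mul_exp_le_setIntegral_prod_villainKernel_pow hK0 hη0 hηπ k
  have hZ := setIntegral_prod_villainKernel_pow_pos hK0 k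
  have hφ0 : 0 ≤ (∏ u, villainKernel K (b u) ^ k u) / ∫ b' in angleCube S, ∏ u, villainKernel K (b' u) ^ k u :=
    div_nonneg (prod_villainKernel_pow_nonneg hK0 k b) hZ.le
  rw [Pi.zero_apply, dist_comm, Real.dist_eq, sub_zero, abs_of_nonneg hφ0]
  refine lt_of_le_of_lt ?_ hKε
  have hden0 : 0 < (2 * η) ^ Fintype.card S * Real.exp (-(K / 2) * η ^ 2 * ∑ u, k u) := by positivity
  calc (∏ u, villainKernel K (b u) ^ k u) / ∫ b' in angleCube S, ∏ u, villainKernel K (b' u) ^ k u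
      ≤ (5 ^ N * Real.exp (-(K / 2) * δ ^ 2)) /
          ((2 * η) ^ Fintype.card S * Real.exp (-(K / 2) * η ^ 2 * ∑ u, k u)) := by
        rw [hN]
        exact div_le_div₀ (by positivity) hnum hden0 hden
    _ = C * Real.exp (-(K / 2) * δ ^ 2 + (K / 2) * η ^ 2 * N) := by
        rw [hC, Real.exp_add, show (K / 2) * η ^ 2 * N = -(-(K / 2) * η ^ 2 * ∑ u, k u) by rw [hN]; ring,
          Real.exp_neg]
        field_simp
    _ ≤ C * Real.exp (-(δ ^ 2 / 4) * K) := by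
        refine mul_le_mul_of_nonneg_left (Real.exp_le_exp.2 ?_) hC0
        nlinarith [mul_le_mul_of_nonneg_left hηN (by linarith : (0 : ℝ) ≤ K / 2)]

/-- **The pinning limit** (`K → ∞`). Let `G` be a bounded continuous function of
`(b, a) ∈ ℝ^S × ℝ^I` and `k_u ≥ 1`. Then
`(∫_{[-π,π)^S × [-π,π)^I} G(b,a) ∏_u v_K(b_u)^{k_u}) / (∫_{[-π,π)^S} ∏_u v_K(b_u)^{k_u}) → ∫_{[-π,π)^I} G(0, a) da`:
against the normalised weights, which concentrate at `b = 0` (Mathlib's peak-function lemma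
`tendsto_setIntegral_peak_smul_of_integrableOn_of_tendsto`), the `b`-coordinates get pinned to `0`.
[folklore] -/
theorem tendsto_setIntegral_mul_prod_villainKernel_pow_div (G : (S → ℝ) × (I → ℝ) → ℝ)
    (hG : Continuous G) {B : ℝ} (hB : ∀ p, |G p| ≤ B) (k : S → ℕ) (hk : ∀ u, 1 ≤ k u) :
    Tendsto (fun K : ℝ =>
        (∫ p in angleCube S ×ˢ angleCube I, G p * ∏ u, villainKernel K (p.1 u) ^ k u) /
          ∫ b in angleCube S, ∏ u, villainKernel K (b u) ^ k u)
      atTop (𝓝 (∫ a in angleCube I, G (0, a))) := by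
  set g : (S → ℝ) → ℝ := fun b => ∫ a in angleCube I, G (b, a) with hg
  haveI : IsFiniteMeasure (volume.restrict (angleCube I)) :=
    isFiniteMeasure_restrict.2 volume_angleCube_ne_top
  -- `g` is continuous (dominated convergence)
  have hgc : Continuous g := by
    refine continuous_of_dominated (F := fun b a => G (b, a)) (bound := fun _ => B)
      (μ := volume.restrict (angleCube I)) (fun b => ?_)
      (fun b => Filter.Eventually.of_forall fun a => ?_) (integrable_const B)
      (Filter.Eventually.of_forall fun a => ?_)
    · exact (hG.comp (continuous_const.prodMk continuous_id)).aestronglyMeasurable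
    · rw [Real.norm_eq_abs]; exact hB _
    · exact hG.comp (continuous_id.prodMk continuous_const)
  -- compact closed cubes containing the angle cubes
  have hKS : IsCompact (Set.pi univ fun _ : S => Icc (-Real.pi) Real.pi) := isCompact_univ_pi fun _ => isCompact_Icc
  have hKI : IsCompact (Set.pi univ fun _ : I => Icc (-Real.pi) Real.pi) := isCompact_univ_pi fun _ => isCompact_Icc
  have hsubS : angleCube S ⊆ Set.pi univ fun _ : S => Icc (-Real.pi) Real.pi :=
    Set.pi_mono fun _ _ => Ico_subset_Icc_self
  have hsubI : angleCube I ⊆ Set.pi univ fun _ : I => Icc (-Real.pi) Real.pi :=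
    Set.pi_mono fun _ _ => Ico_subset_Icc_self
  -- Step 1: the numerator as an iterated integral
  have hnum : ∀ K : ℝ, 0 < K →
      ∫ p in angleCube S ×ˢ angleCube I, G p * ∏ u, villainKernel K (p.1 u) ^ k u =
        ∫ b in angleCube S, (∏ u, villainKernel K (b u) ^ k u) * g b := by
    intro K hK
    have hcont : Continuous fun p : (S → ℝ) × (I → ℝ) => G p * ∏ u, villainKernel K (p.1 u) ^ k u :=
      hG.mul ((continuous_prod_villainKernel_pow hK k).comp continuous_fst)
    have hint : IntegrableOn (fun p : (S → ℝ) × (I → ℝ) => G p * ∏ u, villainKernel K (p.1 u) ^ k u)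
        (angleCube S ×ˢ angleCube I) ((volume : Measure (S → ℝ)).prod (volume : Measure (I → ℝ))) := by
      rw [← Measure.volume_eq_prod]
      exact (hcont.continuousOn.integrableOn_compact (hKS.prod hKI)).mono_set (Set.prod_mono hsubS hsubI)
    rw [Measure.volume_eq_prod, setIntegral_prod _ hint]
    refine setIntegral_congr_fun measurableSet_angleCube' fun b _ => ?_
    simp only [hg]
    rw [← integral_const_mul]
    refine integral_congr_ae (Filter.Eventually.of_forall fun a => ?_)
    simp only
    ring
  -- Step 2: the peak-function lemma for the normalised weights
  have hpeak : Tendsto (fun K : ℝ => ∫ b in angleCube S,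
      ((∏ u, villainKernel K (b u) ^ k u) / ∫ b' in angleCube S, ∏ u, villainKernel K (b' u) ^ k u) • g b)
      atTop (𝓝 (g 0)) := by
    refine tendsto_setIntegral_peak_smul_of_integrableOn_of_tendsto (μ := volume) (x₀ := (0 : S → ℝ))
      measurableSet_angleCube' measurableSet_angleCube' subset_rfl self_mem_nhdsWithin
      volume_angleCube_ne_top ?_ ?_ ?_ ?_ ?_ ?_
    · filter_upwards [eventually_gt_atTop (0 : ℝ)] with K hK b _
      exact div_nonneg (prod_villainKernel_pow_nonneg hK k b) (setIntegral_prod_villainKernel_pow_pos hK k).le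
    · intro U hU hU0
      exact tendstoUniformlyOn_prod_villainKernel_pow_div k hk hU hU0
    · refine tendsto_const_nhds.congr' ?_
      filter_upwards [eventually_gt_atTop (0 : ℝ)] with K hK
      rw [integral_div, div_self (setIntegral_prod_villainKernel_pow_pos hK k).ne']
    · filter_upwards [eventually_gt_atTop (0 : ℝ)] with K hK
      exact ((continuous_prod_villainKernel_pow hK k).div_const _).aestronglyMeasurable
    · exact (hgc.continuousOn.integrableOn_compact hKS).mono_set hsubS
    · exact (hgc.tendsto 0).mono_left nhdsWithin_le_nhds
  -- Step 3: identification
  have heq : (fun K : ℝ => ∫ b in angleCube S,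
      ((∏ u, villainKernel K (b u) ^ k u) / ∫ b' in angleCube S, ∏ u, villainKernel K (b' u) ^ k u) • g b)
      =ᶠ[atTop] fun K : ℝ =>
        (∫ p in angleCube S ×ˢ angleCube I, G p * ∏ u, villainKernel K (p.1 u) ^ k u) /
          ∫ b in angleCube S, ∏ u, villainKernel K (b u) ^ k u := by
    filter_upwards [eventually_gt_atTop (0 : ℝ)] with K hK
    rw [hnum K hK, ← integral_div]
    refine integral_congr_ae (Filter.Eventually.of_forall fun b => ?_)
    simp only [smul_eq_mul]
    ring
  exact hpeak.congr' heq

/-- **The pinning limit for ratios.** For bounded continuous `G, G'` on `ℝ^S × ℝ^I` with `G' > 0`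
and `k_u ≥ 1`:
`(∫ G ∏_u v_K(b_u)^{k_u}) / (∫ G' ∏_u v_K(b_u)^{k_u}) → (∫_{[-π,π)^I} G(0,a) da)/(∫_{[-π,π)^I} G'(0,a) da)`
as `K → ∞` (integrals over `[-π,π)^S × [-π,π)^I`). This is the form in which the zero boundary
condition on the `b`-block is obtained as the infinite-stiffness limit of Gibbs expectations.
[folklore] -/
theorem tendsto_setIntegral_mul_prod_villainKernel_pow_div_setIntegral (G G' : (S → ℝ) × (I → ℝ) → ℝ)
    (hG : Continuous G) (hG' : Continuous G') {B : ℝ} (hB : ∀ p, |G p| ≤ B) (hB' : ∀ p, |G' p| ≤ B)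
    (hpos : 0 < ∫ a in angleCube I, G' (0, a)) (k : S → ℕ) (hk : ∀ u, 1 ≤ k u) :
    Tendsto (fun K : ℝ =>
        (∫ p in angleCube S ×ˢ angleCube I, G p * ∏ u, villainKernel K (p.1 u) ^ k u) /
          ∫ p in angleCube S ×ˢ angleCube I, G' p * ∏ u, villainKernel K (p.1 u) ^ k u)
      atTop (𝓝 ((∫ a in angleCube I, G (0, a)) / ∫ a in angleCube I, G' (0, a))) := by
  have h1 := tendsto_setIntegral_mul_prod_villainKernel_pow_div G hG hB k hk
  have h2 := tendsto_setIntegral_mul_prod_villainKernel_pow_div G' hG' hB' k hk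
  have h := h1.div h2 hpos.ne'
  refine h.congr' ?_
  filter_upwards [eventually_gt_atTop (0 : ℝ)] with K hK
  have hZ := (setIntegral_prod_villainKernel_pow_pos (S := S) hK k).ne'
  simp only [Pi.div_apply]
  rw [div_div_div_cancel_right₀ hZ]

end Peak

/-! ### Transport: pinning a block of coordinates of a single angle cube `[-π,π)^V` -/

section Transport

variable {V : Type*} [Fintype V] (p : V → Prop) [DecidablePred p]

/-- **Splitting the angle cube along a predicate**: `[-π,π)^V ≅ [-π,π)^{p} × [-π,π)^{¬p}`
(Mathlib's volume-preserving `MeasurableEquiv.piEquivPiSubtypeProd`), as an identity of set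
integrals. [folklore] -/
theorem setIntegral_angleCube_eq_setIntegral_prod (F : (V → ℝ) → ℝ) :
    ∫ θ in angleCube V, F θ =
      ∫ q in angleCube {v // p v} ×ˢ angleCube {v // ¬p v},
        F ((MeasurableEquiv.piEquivPiSubtypeProd (fun _ : V => ℝ) p).symm q) := by
  set e := MeasurableEquiv.piEquivPiSubtypeProd (fun _ : V => ℝ) p with he
  have hmp : MeasurePreserving e.symm volume volume :=
    (volume_preserving_piEquivPiSubtypeProd (fun _ : V => ℝ) p).symm e
  have hpre : e.symm ⁻¹' angleCube V = angleCube {v // p v} ×ˢ angleCube {v // ¬p v} :=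
    Equiv.preimage_piEquivPiSubtypeProd_symm_pi p fun _ : V => Ico (-Real.pi) Real.pi
  rw [← hpre]
  exact (hmp.setIntegral_preimage_emb e.symm.measurableEmbedding F (angleCube V)).symm

omit [Fintype V] in
/-- The inverse splitting map on the pinned block: `(e⁻¹(b, a))_u = b_u` for `p u`. [folklore] -/
theorem piEquivPiSubtypeProd_symm_apply_of_pos (q : ({v // p v} → ℝ) × ({v // ¬p v} → ℝ))
    (u : {v // p v}) :
    (MeasurableEquiv.piEquivPiSubtypeProd (fun _ : V => ℝ) p).symm q u = q.1 u := by
  show (Equiv.piEquivPiSubtypeProd p (fun _ : V => ℝ)).symm q u = q.1 u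
  rw [Equiv.piEquivPiSubtypeProd_symm_apply, dif_pos u.2]

omit [Fintype V] in
/-- The inverse splitting map is continuous. [folklore] -/
theorem continuous_piEquivPiSubtypeProd_symm :
    Continuous fun q : ({v // p v} → ℝ) × ({v // ¬p v} → ℝ) =>
      (MeasurableEquiv.piEquivPiSubtypeProd (fun _ : V => ℝ) p).symm q := by
  refine continuous_pi fun v => ?_
  show Continuous fun q : ({v // p v} → ℝ) × ({v // ¬p v} → ℝ) =>
    (Equiv.piEquivPiSubtypeProd p (fun _ : V => ℝ)).symm q v
  simp only [Equiv.piEquivPiSubtypeProd_symm_apply]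
  by_cases hv : p v
  · simp only [hv, dite_true]
    exact (continuous_apply _).comp continuous_fst
  · simp only [hv, dite_false]
    exact (continuous_apply _).comp continuous_snd

/-- **The pinning limit on a single cube.** Let `g, g'` be bounded continuous functions on `ℝ^V`,
`p` the set of pinned coordinates with multiplicities `k_u ≥ 1`, and suppose
`∫_{[-π,π)^{¬p}} g'(ā) da > 0`, where `ā ∈ ℝ^V` is `a` extended by `0` on the pinned coordinates
(`ā = e⁻¹(0, a)`). Then, as `K → ∞`,
`(∫_{[-π,π)^V} g(θ) ∏_{u ∈ p} v_K(θ_u)^{k_u} dθ) / (∫_{[-π,π)^V} g'(θ) ∏_{u ∈ p} v_K(θ_u)^{k_u} dθ)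
  → (∫ g(ā) da) / (∫ g'(ā) da)`:
Gibbs expectations with the pinned coordinates coupled to `0` with stiffness `K` converge to the
expectations with those coordinates set to `0` (zero boundary condition). [folklore] -/
theorem tendsto_setIntegral_mul_prod_villainKernel_pow_div_of_pinned (g g' : (V → ℝ) → ℝ)
    (hg : Continuous g) (hg' : Continuous g') {B : ℝ} (hB : ∀ θ, |g θ| ≤ B) (hB' : ∀ θ, |g' θ| ≤ B)
    (k : {v // p v} → ℕ) (hk : ∀ u, 1 ≤ k u)
    (hpos : 0 < ∫ a in angleCube {v // ¬p v},
      g' ((MeasurableEquiv.piEquivPiSubtypeProd (fun _ : V => ℝ) p).symm (0, a))) :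
    Tendsto (fun K : ℝ =>
        (∫ θ in angleCube V, g θ * ∏ u : {v // p v}, villainKernel K (θ u) ^ k u) /
          ∫ θ in angleCube V, g' θ * ∏ u : {v // p v}, villainKernel K (θ u) ^ k u)
      atTop (𝓝 ((∫ a in angleCube {v // ¬p v},
          g ((MeasurableEquiv.piEquivPiSubtypeProd (fun _ : V => ℝ) p).symm (0, a))) /
        ∫ a in angleCube {v // ¬p v},
          g' ((MeasurableEquiv.piEquivPiSubtypeProd (fun _ : V => ℝ) p).symm (0, a)))) := by
  set e := MeasurableEquiv.piEquivPiSubtypeProd (fun _ : V => ℝ) p with he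
  have hec : Continuous fun q : ({v // p v} → ℝ) × ({v // ¬p v} → ℝ) => e.symm q :=
    continuous_piEquivPiSubtypeProd_symm p
  have hsplit : ∀ (h : (V → ℝ) → ℝ) (K : ℝ),
      ∫ θ in angleCube V, h θ * ∏ u : {v // p v}, villainKernel K (θ u) ^ k u =
        ∫ q in angleCube {v // p v} ×ˢ angleCube {v // ¬p v},
          (h ∘ e.symm) q * ∏ u, villainKernel K (q.1 u) ^ k u := by
    intro h K
    rw [setIntegral_angleCube_eq_setIntegral_prod p]
    refine setIntegral_congr_fun (measurableSet_angleCube'.prod measurableSet_angleCube') fun q _ => ?_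
    simp only [Function.comp_apply, piEquivPiSubtypeProd_symm_apply_of_pos, he]
  simp_rw [hsplit]
  exact tendsto_setIntegral_mul_prod_villainKernel_pow_div_setIntegral (g ∘ e.symm) (g' ∘ e.symm)
    (hg.comp hec) (hg'.comp hec) (fun q => hB _) (fun q => hB' _) hpos k hk

end Transport

end Literature.Probability.LatticeModels
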